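import Summits.QuantumFields.YangMills.Theorems.AlphaInputsT3ACv3PerturbedPlaquette
import HarnessLib

/-!
# `AlphaInputsT3ACv3BlendLetters` — two bookkeeping letters for the START∕glue step of the non-abelian (FL) row: (§1) **TWO GAUGES OF ONE FIELD DIFFER BY A SLOWLY VARYING
# TRANSFORMATION** — `r = h₂h₁⁻¹` moves along a bond by at most `dist1(W^{h₁}(b)) + dist1(W^{h₂}(b))` (any `GaugeGroup`, any background); (§2) **THE COVARIANT CURL OF A CUT-OFF
# PERTURBATION** — `‖covCurl(χ·D)(p)‖ ≤ |χ(x)|·‖covCurl D (p)‖ + |dχ(x,μ)|·‖D₂‖ + |dχ(x,ν)|·‖D₃‖` (product rule behind `…v3PerturbedPlaquette.dist1_plaqHol_perturb_le`) — cell `ym3-torus`,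
# width seat `ym-ust-19936-w2` (g2)

WHY (w1-19936 NEWTON v2.1 rows R5 «relative axial gauges on a stencil are constant up to O(ε)» and R9′ «glue the stencil candidates with the σ-profile partition of unity, cost
|dχ|·m_glue + m_glue²»; w4-19936 `NEWTON-FL-FRAMES` §4; this seat's `…LinearLiftCutoff` supplies `χ = S0 k 1_Y` with `|χ| ≤ 18^d`, `|dχ| ≤ 18^d/L^k`).  §1 is the frame letter: two
axial gauges `h₁, h₂` of the same field on a stencil differ by `r = h₂h₁⁻¹` whose increments along bonds are controlled by the gauged bond variables ONLY (so `r = T·exp λ` with `T`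
constant and `λ` of the size of the stencil's plaquette budget times its diameter; chain with `dist1_inv_mul_chain`).  §2 is the blend letter: multiplying a perturbation `D` by a scalar
cutoff read at the bond's source costs, in the covariant curl at ANY background, the cutoff's gradient against the sup of `D` — the `|dχ|·m_glue` term.
WHAT (no definitions).  §1 `inv_mul_relGauge_eq` (the group identity `r(b₋)⁻¹r(b₊) = [r(b₋)⁻¹ (W^{h₂} b)⁻¹ r(b₋)]·W^{h₁} b`), ★ `dist1_relGauge_step_le`, `dist1_inv_mul_chain`;
§2 `conj_smul_SU` (`g (c•X) g* = c • gXg*`), ★ `norm_covCurl_smul_le`.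
HONEST FRAMING.  Group∕matrix bookkeeping; count-neutral helper toward the (FL) row of 2′∕2′χ (`--supports stmt-QuantumFields-19936`); (FL)∕`hLift` is NOT proved here; registry untouched.
YM₃ on the three-torus is RUNG R3 of the programme, not the Clay problem; no claim about d = 4, infinite volume or a mass gap.

References: T. Bałaban, Commun. Math. Phys. 98 (1985) 17–51 [Balaban1985Averaging] ((8)–(9) pp.18–19, (19) p.21); Commun. Math. Phys. 99 (1985) 75–102 [Balaban1985RegularSpaces]
(Lemma 1 (1.25) p.79, axial gauges).
-/

set_option autoImplicit false

noncomputable section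

open scoped Matrix.Norms.L2Operator

namespace Summit.QuantumFields.YangMills.Theorems.PerturbedPlaquette

open Literature.MathematicalPhysics.QuantumFieldTheory.Balaban1983to89

/-! ## §1 Two gauges of one field: the relative transformation is slowly varying -/

section RelGauge

variable {P : Params} {j : ℕ} {G : Type*} [GaugeGroup G]

/-- The group identity behind the frame letter: with `r = h₂h₁⁻¹`, `r(b₋)⁻¹·r(b₊) = [r(b₋)⁻¹·(W^{h₂}(b))⁻¹·r(b₋)]·W^{h₁}(b)`. [cite: Balaban1985Averaging, (8) p.19] -/
theorem inv_mul_relGauge_eq (h₁ h₂ : GaugeTransf P j G) (W : GaugeField P j G) (b : PBond P j) :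
    (h₂ b.src * (h₁ b.src)⁻¹)⁻¹ * (h₂ b.tgt * (h₁ b.tgt)⁻¹) =
      ((h₂ b.src * (h₁ b.src)⁻¹)⁻¹ * (GaugeField.gaugeAct h₂ W b)⁻¹ * (h₂ b.src * (h₁ b.src)⁻¹)) * GaugeField.gaugeAct h₁ W b := by
  simp only [GaugeField.gaugeAct]
  group

/-- **★ THE FRAME LETTER**: two gauges `h₁, h₂` of the same field `W` differ by `r = h₂h₁⁻¹` with `dist1 (r(b₋)⁻¹ r(b₊)) ≤ dist1 (W^{h₁} b) + dist1 (W^{h₂} b)` on every bond — at ANY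
background, in any `GaugeGroup` (conjugation invariance, inversion invariance and subadditivity of `dist1` only). [cite: Balaban1985RegularSpaces, Lemma 1 (1.25) p.79] -/
theorem dist1_relGauge_step_le (h₁ h₂ : GaugeTransf P j G) (W : GaugeField P j G) (b : PBond P j) :
    dist1 ((h₂ b.src * (h₁ b.src)⁻¹)⁻¹ * (h₂ b.tgt * (h₁ b.tgt)⁻¹)) ≤ dist1 (GaugeField.gaugeAct h₁ W b) + dist1 (GaugeField.gaugeAct h₂ W b) := by
  rw [inv_mul_relGauge_eq h₁ h₂ W b]
  have hconj : dist1 ((h₂ b.src * (h₁ b.src)⁻¹)⁻¹ * (GaugeField.gaugeAct h₂ W b)⁻¹ * (h₂ b.src * (h₁ b.src)⁻¹)) = dist1 (GaugeField.gaugeAct h₂ W b) := by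
    have h := GaugeGroup.dist1_conj (GaugeField.gaugeAct h₂ W b)⁻¹ (h₂ b.src * (h₁ b.src)⁻¹)⁻¹
    rw [inv_inv] at h
    rw [h, GaugeGroup.dist1_inv]
  calc dist1 ((h₂ b.src * (h₁ b.src)⁻¹)⁻¹ * (GaugeField.gaugeAct h₂ W b)⁻¹ * (h₂ b.src * (h₁ b.src)⁻¹) * GaugeField.gaugeAct h₁ W b)
      ≤ dist1 ((h₂ b.src * (h₁ b.src)⁻¹)⁻¹ * (GaugeField.gaugeAct h₂ W b)⁻¹ * (h₂ b.src * (h₁ b.src)⁻¹)) + dist1 (GaugeField.gaugeAct h₁ W b) :=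
        GaugeGroup.dist1_mul_le _ _
    _ = dist1 (GaugeField.gaugeAct h₁ W b) + dist1 (GaugeField.gaugeAct h₂ W b) := by rw [hconj, add_comm]

omit [GaugeGroup G] in
/-- **CHAINING RELATIVE ROTATIONS**: `dist1 (a⁻¹c) ≤ dist1 (a⁻¹b) + dist1 (b⁻¹c)` (so along a walk the relative transformation of §1 moves by at most the sum of the bond budgets).
[cite: Balaban1985RegularSpaces, Lemma 1 (1.25) p.79] -/
theorem dist1_inv_mul_chain [GaugeGroup G] (a b c : G) : dist1 (a⁻¹ * c) ≤ dist1 (a⁻¹ * b) + dist1 (b⁻¹ * c) := by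
  have e : a⁻¹ * c = (a⁻¹ * b) * (b⁻¹ * c) := by group
  rw [e]
  exact GaugeGroup.dist1_mul_le _ _

end RelGauge

/-! ## §2 The covariant curl of a cut-off perturbation -/

section Blend

variable {n : Type*} [Fintype n] [DecidableEq n]

/-- A real scalar passes through a unitary conjugation: `g (c • X) g* = c • (g X g*)`. [folklore] -/
theorem conj_smul_SU (g : Matrix.specialUnitaryGroup n ℂ) (c : ℝ) (X : Matrix n n ℂ) :
    (g : Matrix n n ℂ) * (c • X) * star (g : Matrix n n ℂ) = c • ((g : Matrix n n ℂ) * X * star (g : Matrix n n ℂ)) := by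
  rw [Matrix.mul_smul, Matrix.smul_mul]

variable [Nonempty n] {P : Params} {j : ℕ}

/-- **★ THE BLEND LETTER — THE COVARIANT CURL OF A CUT-OFF PERTURBATION**: for `a_b = χ(b₋) • D_b` (a real cutoff read at the source of each bond) and the covariant curl of
`…v3PerturbedPlaquette` at ANY background `U` (`W = U(∂p)`, `g = U₁U₂U₃⁻¹`):
`‖a₁ + U₁a₂U₁* − g a₃ g* − W a₄ W*‖ ≤ |χ(x)|·‖D₁ + U₁D₂U₁* − g D₃ g* − W D₄ W*‖ + |χ(x+e_μ) − χ(x)|·‖D₂‖ + |χ(x+e_ν) − χ(x)|·‖D₃‖` — the cutoff's gradient against the sup of `D`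
(the `|dχ|·m_glue` term of a partition-of-unity blend), plus the cut-off covariant curl. [cite: Balaban1985Averaging, (9) p.19, (19) p.21] -/
theorem norm_covCurl_smul_le (U : GaugeField P j (Matrix.specialUnitaryGroup n ℂ)) (χ : Site P j → ℝ) (D : PBond P j → Matrix n n ℂ) (p : Plaq P j) :
    ‖χ p.src • D ⟨p.src, p.μ⟩ + (U ⟨p.src, p.μ⟩ : Matrix n n ℂ) * (χ (p.src.shift p.μ) • D ⟨p.src.shift p.μ, p.ν⟩) * star (U ⟨p.src, p.μ⟩ : Matrix n n ℂ)
        - ((U ⟨p.src, p.μ⟩ * U ⟨p.src.shift p.μ, p.ν⟩ * (U ⟨p.src.shift p.ν, p.μ⟩)⁻¹ : Matrix.specialUnitaryGroup n ℂ) : Matrix n n ℂ) * (χ (p.src.shift p.ν) • D ⟨p.src.shift p.ν, p.μ⟩) *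
            star ((U ⟨p.src, p.μ⟩ * U ⟨p.src.shift p.μ, p.ν⟩ * (U ⟨p.src.shift p.ν, p.μ⟩)⁻¹ : Matrix.specialUnitaryGroup n ℂ) : Matrix n n ℂ)
        - ((GaugeField.plaqHol U p : Matrix.specialUnitaryGroup n ℂ) : Matrix n n ℂ) * (χ p.src • D ⟨p.src, p.ν⟩) *
            star ((GaugeField.plaqHol U p : Matrix.specialUnitaryGroup n ℂ) : Matrix n n ℂ)‖ ≤
      |χ p.src| * ‖D ⟨p.src, p.μ⟩ + (U ⟨p.src, p.μ⟩ : Matrix n n ℂ) * D ⟨p.src.shift p.μ, p.ν⟩ * star (U ⟨p.src, p.μ⟩ : Matrix n n ℂ)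
        - ((U ⟨p.src, p.μ⟩ * U ⟨p.src.shift p.μ, p.ν⟩ * (U ⟨p.src.shift p.ν, p.μ⟩)⁻¹ : Matrix.specialUnitaryGroup n ℂ) : Matrix n n ℂ) * D ⟨p.src.shift p.ν, p.μ⟩ *
            star ((U ⟨p.src, p.μ⟩ * U ⟨p.src.shift p.μ, p.ν⟩ * (U ⟨p.src.shift p.ν, p.μ⟩)⁻¹ : Matrix.specialUnitaryGroup n ℂ) : Matrix n n ℂ)
        - ((GaugeField.plaqHol U p : Matrix.specialUnitaryGroup n ℂ) : Matrix n n ℂ) * D ⟨p.src, p.ν⟩ *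
            star ((GaugeField.plaqHol U p : Matrix.specialUnitaryGroup n ℂ) : Matrix n n ℂ)‖ +
      |χ (p.src.shift p.μ) - χ p.src| * ‖D ⟨p.src.shift p.μ, p.ν⟩‖ + |χ (p.src.shift p.ν) - χ p.src| * ‖D ⟨p.src.shift p.ν, p.μ⟩‖ := by
  set g : Matrix.specialUnitaryGroup n ℂ := U ⟨p.src, p.μ⟩ * U ⟨p.src.shift p.μ, p.ν⟩ * (U ⟨p.src.shift p.ν, p.μ⟩)⁻¹ with hg
  set W : Matrix.specialUnitaryGroup n ℂ := GaugeField.plaqHol U p with hW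
  set c₀ : ℝ := χ p.src
  set cμ : ℝ := χ (p.src.shift p.μ)
  set cν : ℝ := χ (p.src.shift p.ν)
  set D₁ : Matrix n n ℂ := D ⟨p.src, p.μ⟩
  set K₂ : Matrix n n ℂ := (U ⟨p.src, p.μ⟩ : Matrix n n ℂ) * D ⟨p.src.shift p.μ, p.ν⟩ * star (U ⟨p.src, p.μ⟩ : Matrix n n ℂ) with hK₂
  set K₃ : Matrix n n ℂ := (g : Matrix n n ℂ) * D ⟨p.src.shift p.ν, p.μ⟩ * star (g : Matrix n n ℂ) with hK₃
  set K₄ : Matrix n n ℂ := (W : Matrix n n ℂ) * D ⟨p.src, p.ν⟩ * star (W : Matrix n n ℂ) with hK₄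
  rw [conj_smul_SU, conj_smul_SU, conj_smul_SU]
  -- `c₀D₁ + cμK₂ − cνK₃ − c₀K₄ = c₀(D₁ + K₂ − K₃ − K₄) + (cμ − c₀)K₂ − (cν − c₀)K₃`
  have e : c₀ • D₁ + cμ • K₂ - cν • K₃ - c₀ • K₄ = c₀ • (D₁ + K₂ - K₃ - K₄) + (cμ - c₀) • K₂ - (cν - c₀) • K₃ := by
    simp only [smul_add, smul_sub, sub_smul]
    abel
  rw [e]
  have n₂ : ‖K₂‖ = ‖D ⟨p.src.shift p.μ, p.ν⟩‖ := norm_conj_SU _ _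
  have n₃ : ‖K₃‖ = ‖D ⟨p.src.shift p.ν, p.μ⟩‖ := norm_conj_SU _ _
  calc ‖c₀ • (D₁ + K₂ - K₃ - K₄) + (cμ - c₀) • K₂ - (cν - c₀) • K₃‖
      ≤ ‖c₀ • (D₁ + K₂ - K₃ - K₄)‖ + ‖(cμ - c₀) • K₂‖ + ‖(cν - c₀) • K₃‖ := by
        refine (norm_sub_le _ _).trans (add_le_add (norm_add_le _ _) le_rfl)
    _ = |c₀| * ‖D₁ + K₂ - K₃ - K₄‖ + |cμ - c₀| * ‖D ⟨p.src.shift p.μ, p.ν⟩‖ + |cν - c₀| * ‖D ⟨p.src.shift p.ν, p.μ⟩‖ := by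
        rw [norm_smul, norm_smul, norm_smul, Real.norm_eq_abs, Real.norm_eq_abs, Real.norm_eq_abs, n₂, n₃]

end Blend

end Summit.QuantumFields.YangMills.Theorems.PerturbedPlaquette

end
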